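import Summits.ValiantsHypothesis.ValiantsHypothesis.Theorems.KPlusLogSqLawTropicalOrbitChainAbstract

/-!
# Tropical census, symmetric `3 × 3` designs — the THREE-TERM MAJORISATION RULE of the orbit model («T-triple» / centroid rule)

HONEST FRAMING.  Helper file (seat val-sym-lift-p2 (g7), cell `pub-symmetroid`, 2026-08-27; `--supports` the `WeakLifting` item
stmt-ValiantsHypothesis-19561 as a helper, no closure claim).  Pure lemma file in the transpose-ORBIT carrier model of the tree
(`…TropicalOrbitDominance`: `IsOrbitDominant`, `TropRootLawAtSymmOrb`).  It supplies the NON-PAIRWISE ingredient that the desk's docket of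
record «the 16» (R1797/R1798) asks for: the pairwise exchange rules M / S / R1w–R3′w are exhausted at `17` (`core_hypotheses_admit_seventeen`,
p505165), and the abstract 17-chain exhibited there contains three cycle-constant transposition terms `T₀(3;0), T₁(1;1), T₂(0;2)` (one per
fixed cell) which the rule below excludes.

THE RULE.  Three orbit-dominant transposition terms `pa = (swap j k, ξa)`, `pb = (swap i k, ξb)`, `pc = (swap i j, ξc)` of a symmetric
`3 × 3` design, cycle-constant, one for each fixed cell `i, j, k`, recombine LETTER-WISE into the identity term `D = (1, [i ↦ ξa i, j ↦ ξb j,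
k ↦ ξc k])` and TWICE the pair carrier `C = (σ, ν)` (`σ : i ↦ j ↦ k ↦ i`, pair `{i,j}` lettered `ξc i`, `{j,k}` lettered `ξa j`, `{i,k}`
lettered `ξb k`): at every slope `W(pa) + W(pb) + W(pc) = W(D) + 2·W(C)` (`tropWeight` is affine in the letters' exponents and heights).
Both hybrids are present (their letters are letters of the three dominant terms at the same cells) and lie outside the three transpose
orbits (different carriers).  In the plane (exponent sum `A`, height `V`) a term orbit-dominant at some slope is a strict lower vertex, hence
strictly below the chord between any two present points bracketing it in `A`; so if `A(C) ≤ A(p) ≤ A(D)` for all three `p` (or all three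
reversed), the centroid of the three points lies strictly below the chord `[C, D]` — but by the recombination identity the centroid IS the
point `(2C + D)/3` of that chord.  Hence (`rule_T3`): NOT all three bracketed.  No slope order, no adjacency, no genericity, integer slopes.
(General principle, of which the pairwise rules are the case `r = 2`: if orbit-dominant `p₁..p_r` recombine letter-wise into present
`q₁..q_r` outside their orbits, the exponent-sum multiset of the `q`'s does not majorise that of the `p`'s — Karamata on the lower hull.)

CONTENTS.  `slot_chord` / `centroid3` (the integer arithmetic); closed forms `tropWeight_one_three`, `tropWeight_swap_three`,
`tropWeight_cycle_three`; **`rule_T3`** (hypothesis-free, general `K`); the rank-form chain version **`orbitChain_T3`** for the abstract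
interface of `…TropicalOrbitChainAbstract` (letters replaced by ranks via `Tuple.sort d`, exponents `g = d ∘ Tuple.sort d`).
Nothing here is a census numeral: tropical objects bound no real pencil; `TSymOrb34Le16` stays a target (NOT asserted here); ζ_sym(3,4) ∈ {18,19},
DoorA34 = `PosRootLawAt 3 4 18` / DoorA26 untouched (OPEN, typed, never asserted); nothing on `TropicalB` / `WeakLifting` as closed, on
`MatrixDescartes` (stmt-ValiantsHypothesis-18050) or on VP ≠ VNP.  [folklore] (Karamata / lower-hull exchange; seat val-sym-lift-p2 g7)
-/

-- `Summit.ValiantsHypothesis.ValiantsHypothesis.…` is the tree's mandated single-conjunct layout (Sub = Summit).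
set_option linter.dupNamespace false
set_option autoImplicit false

namespace Summit.ValiantsHypothesis.ValiantsHypothesis.Theorems.LacunarySymmetroidMatrixDescartes.TropicalCensus.Orbit

open Summit.ValiantsHypothesis.ValiantsHypothesis.Theorems.MatrixDescartes.Negative
open Summit.ValiantsHypothesis.ValiantsHypothesis.Theorems.LacunarySymmetroidMatrixDescartes
open Summit.ValiantsHypothesis.ValiantsHypothesis.Theorems.LacunarySymmetroidMatrixDescartes.TropicalCensus
open Finset

variable {K : ℕ}

/-! ## The arithmetic: a strict lower vertex lies below every bracketing chord; three of them cannot average onto the chord -/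

/-- **One slot.**  A point `(A, V)` carrying a line of slope `θ` strictly below the two points `(AP, VP)`, `(AQ, VQ)` which bracket it
(`AP ≤ A ≤ AQ`, `AP < AQ`) lies strictly below their chord: `(AQ − AP)·V < (AQ − A)·VP + (A − AP)·VQ`. [folklore] -/
theorem slot_chord {θ A AP AQ V VP VQ : ℤ} (hP : θ * AP - VP < θ * A - V) (hQ : θ * AQ - VQ < θ * A - V)
    (h1 : AP ≤ A) (h2 : A ≤ AQ) (hL : AP < AQ) : (AQ - AP) * V < (AQ - A) * VP + (A - AP) * VQ := by
  rcases eq_or_lt_of_le h1 with e1 | l1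
  · -- `A = AP`: the point is strictly below `P` itself
    subst e1
    have hV : V < VP := by linarith
    nlinarith [mul_lt_mul_of_pos_left hV (sub_pos.mpr hL)]
  rcases eq_or_lt_of_le h2 with e2 | l2
  · subst e2
    have hV : V < VQ := by linarith
    nlinarith [mul_lt_mul_of_pos_left hV (sub_pos.mpr hL)]
  have e1 : (AQ - A) * (θ * AP - VP) < (AQ - A) * (θ * A - V) := mul_lt_mul_of_pos_left hP (sub_pos.mpr l2)
  have e2 : (A - AP) * (θ * AQ - VQ) < (A - AP) * (θ * A - V) := mul_lt_mul_of_pos_left hQ (sub_pos.mpr l1)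
  nlinarith [e1, e2]

/-- **Three slots** (the centroid rule).  Three points, each strictly below both `P` and `Q` along its own slope, whose coordinates add up
to `Q + 2·P`, cannot all be bracketed by `P` and `Q` (in either order). [folklore: Karamata on the lower hull] -/
theorem centroid3 {θa θb θc Aa Ab Ac Va Vb Vc AP VP AQ VQ : ℤ}
    (hA : Aa + Ab + Ac = AQ + 2 * AP) (hV : Va + Vb + Vc = VQ + 2 * VP)
    (haP : θa * AP - VP < θa * Aa - Va) (haQ : θa * AQ - VQ < θa * Aa - Va)
    (hbP : θb * AP - VP < θb * Ab - Vb) (hbQ : θb * AQ - VQ < θb * Ab - Vb)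
    (hcP : θc * AP - VP < θc * Ac - Vc) (hcQ : θc * AQ - VQ < θc * Ac - Vc) :
    ¬ (AP ≤ Aa ∧ AP ≤ Ab ∧ AP ≤ Ac ∧ Aa ≤ AQ ∧ Ab ≤ AQ ∧ Ac ≤ AQ) ∧
      ¬ (AQ ≤ Aa ∧ AQ ≤ Ab ∧ AQ ≤ Ac ∧ Aa ≤ AP ∧ Ab ≤ AP ∧ Ac ≤ AP) := by
  constructor
  · rintro ⟨a1, b1, c1, a2, b2, c2⟩
    rcases eq_or_lt_of_le (a1.trans a2) with hL | hL
    · -- degenerate: all five exponent sums coincide; compare heights directly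
      have ea : Aa = AQ := by omega
      have eb : Ab = AP := by omega
      have ec : Ac = AP := by omega
      subst ea
      rw [eb] at hbP; rw [ec] at hcP; rw [← hL] at haQ
      linarith
    · have sa := slot_chord haP haQ a1 a2 hL
      have sb := slot_chord hbP hbQ b1 b2 hL
      have sc := slot_chord hcP hcQ c1 c2 hL
      have hsum : (AQ - AP) * (Va + Vb + Vc) <
          (3 * AQ - (Aa + Ab + Ac)) * VP + ((Aa + Ab + Ac) - 3 * AP) * VQ := by nlinarith [sa, sb, sc]
      rw [hA, hV] at hsum
      nlinarith [hsum]
  · rintro ⟨a1, b1, c1, a2, b2, c2⟩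
    rcases eq_or_lt_of_le (a1.trans a2) with hL | hL
    · have ea : Aa = AP := by omega
      have eb : Ab = AP := by omega
      have ec : Ac = AP := by omega
      subst ea
      rw [eb] at hbP; rw [ec] at hcP; rw [hL] at haQ
      linarith
    · have sa := slot_chord haQ haP a1 a2 hL
      have sb := slot_chord hbQ hbP b1 b2 hL
      have sc := slot_chord hcQ hcP c1 c2 hL
      have hsum : (AP - AQ) * (Va + Vb + Vc) <
          (3 * AP - (Aa + Ab + Ac)) * VQ + ((Aa + Ab + Ac) - 3 * AQ) * VP := by nlinarith [sa, sb, sc]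
      rw [hA, hV] at hsum
      nlinarith [hsum]

/-! ## Closed forms of the tropical weight for the three carrier shapes of `Fin 3` -/

section Shapes

variable {i j k : Fin 3} (hij : i ≠ j) (hki : k ≠ i) (hkj : k ≠ j)
include hij hki hkj

/-- weight of an identity term, written at the labelling `{i,j,k}`. [bookkeeping] -/
theorem tropWeight_one_three (d : Fin K → ℕ) (v : Fin 3 → Fin 3 → Fin K → ℤ) (θ : ℤ) (lam : Fin 3 → Fin K) :
    tropWeight d v θ (1, lam) =
      θ * ((d (lam i) : ℤ) + d (lam j) + d (lam k)) - (v i i (lam i) + v j j (lam j) + v k k (lam k)) := by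
  unfold tropWeight
  simp only [sum_three hij hki hkj, Equiv.Perm.coe_one, id_eq]

/-- weight of a cycle-constant transposition term `(swap i j, ξ)`, `ξ i = ξ j`, for symmetric heights. [bookkeeping] -/
theorem tropWeight_swap_three (d : Fin K → ℕ) (v : Fin 3 → Fin 3 → Fin K → ℤ) (hv : ∀ a b l, v a b l = v b a l) (θ : ℤ)
    (ξ : Fin 3 → Fin K) (hξ : ξ i = ξ j) :
    tropWeight d v θ (Equiv.swap i j, ξ) =
      θ * ((d (ξ k) : ℤ) + 2 * d (ξ i)) - (v k k (ξ k) + 2 * v i j (ξ i)) := by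
  unfold tropWeight
  simp only [sum_three hij hki hkj, Equiv.swap_apply_left, Equiv.swap_apply_right,
    Equiv.swap_apply_of_ne_of_ne hki hkj]
  rw [← hξ, hv j i (ξ i)]
  ring

/-- weight of the pair carrier `(σ, ν)`, `σ : i ↦ j ↦ k ↦ i`. [bookkeeping] -/
theorem tropWeight_cycle_three (σ : Equiv.Perm (Fin 3)) (hσi : σ i = j) (hσj : σ j = k) (hσk : σ k = i)
    (d : Fin K → ℕ) (v : Fin 3 → Fin 3 → Fin K → ℤ) (θ : ℤ) (ν : Fin 3 → Fin K) :
    tropWeight d v θ (σ, ν) =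
      θ * ((d (ν i) : ℤ) + d (ν j) + d (ν k)) - (v j i (ν i) + v k j (ν j) + v i k (ν k)) := by
  unfold tropWeight
  simp only [sum_three hij hki hkj, hσi, hσj, hσk]

end Shapes

/-! ## The T-triple rule, hypothesis-free -/

section Triple

variable {i j k : Fin 3} (hij : i ≠ j) (hki : k ≠ i) (hkj : k ≠ j)
  (σ : Equiv.Perm (Fin 3)) (hσi : σ i = j) (hσj : σ j = k) (hσk : σ k = i)
include hij hki hkj hσi hσj hσk

/-- **Rule T3 (the T-triple / centroid rule).**  For a symmetric `3 × 3` design with any number of classes: three orbit-dominant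
cycle-constant transposition terms `(swap j k, ξa)`, `(swap i k, ξb)`, `(swap i j, ξc)` — one for each fixed cell `i, j, k`, at arbitrary
slopes — are never simultaneously bracketed (weakly, in exponent sum) by their identity hybrid `D = (1, [ξa i, ξb j, ξc k])` above and their
pair-carrier hybrid `C = (σ, [ξc i on {i,j}, ξa j on {j,k}, ξb k on {i,k}])` below, nor the other way round.  In exponents:
with `AD = d(ξa i) + d(ξb j) + d(ξc k)`, `AC = d(ξc i) + d(ξa j) + d(ξb k)`, `Aa = d(ξa i) + 2 d(ξa j)`, `Ab = d(ξb j) + 2 d(ξb k)`,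
`Ac = d(ξc k) + 2 d(ξc i)`: `¬(AC ≤ Aa, Ab, Ac ≤ AD) ∧ ¬(AD ≤ Aa, Ab, Ac ≤ AC)`. [folklore: Karamata on the lower hull; seat val-sym-lift-p2 g7] -/
theorem rule_T3 (d : Fin K → ℕ) (v ε : Fin 3 → Fin 3 → Fin K → ℤ) (hv : ∀ a b l, v a b l = v b a l)
    {θa θb θc : ℤ} (ξa ξb ξc : Fin 3 → Fin K)
    (ha : IsOrbitDominant d v ε θa (Equiv.swap j k, ξa)) (hca : ξa j = ξa k)
    (hb : IsOrbitDominant d v ε θb (Equiv.swap i k, ξb)) (hcb : ξb i = ξb k)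
    (hc : IsOrbitDominant d v ε θc (Equiv.swap i j, ξc)) (hcc : ξc i = ξc j) :
    ¬ ((d (ξc i) : ℤ) + d (ξa j) + d (ξb k) ≤ d (ξa i) + 2 * d (ξa j) ∧
        (d (ξc i) : ℤ) + d (ξa j) + d (ξb k) ≤ d (ξb j) + 2 * d (ξb k) ∧
        (d (ξc i) : ℤ) + d (ξa j) + d (ξb k) ≤ d (ξc k) + 2 * d (ξc i) ∧
        (d (ξa i) : ℤ) + 2 * d (ξa j) ≤ d (ξa i) + d (ξb j) + d (ξc k) ∧
        (d (ξb j) : ℤ) + 2 * d (ξb k) ≤ d (ξa i) + d (ξb j) + d (ξc k) ∧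
        (d (ξc k) : ℤ) + 2 * d (ξc i) ≤ d (ξa i) + d (ξb j) + d (ξc k)) ∧
    ¬ ((d (ξa i) : ℤ) + d (ξb j) + d (ξc k) ≤ d (ξa i) + 2 * d (ξa j) ∧
        (d (ξa i) : ℤ) + d (ξb j) + d (ξc k) ≤ d (ξb j) + 2 * d (ξb k) ∧
        (d (ξa i) : ℤ) + d (ξb j) + d (ξc k) ≤ d (ξc k) + 2 * d (ξc i) ∧
        (d (ξa i) : ℤ) + 2 * d (ξa j) ≤ d (ξc i) + d (ξa j) + d (ξb k) ∧
        (d (ξb j) : ℤ) + 2 * d (ξb k) ≤ d (ξc i) + d (ξa j) + d (ξb k) ∧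
        (d (ξc k) : ℤ) + 2 * d (ξc i) ≤ d (ξc i) + d (ξa j) + d (ξb k)) := by
  have hjk : j ≠ k := fun h => hkj h.symm
  have hik : i ≠ k := fun h => hki h.symm
  -- the two hybrids
  let lam : Fin 3 → Fin K := fun l => if l = i then ξa i else if l = j then ξb j else ξc k
  let ν : Fin 3 → Fin K := fun l => if l = i then ξc i else if l = j then ξa j else ξb k
  have li : lam i = ξa i := by simp [lam]
  have lj : lam j = ξb j := by simp [lam, hij.symm]
  have lk : lam k = ξc k := by simp [lam, hki, hkj]
  have ni : ν i = ξc i := by simp [ν]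
  have nj : ν j = ξa j := by simp [ν, hij.symm]
  have nk : ν k = ξb k := by simp [ν, hki, hkj]
  -- presence of the letters of the three dominant terms
  have pa := present_of_termSign_ne_zero ε _ ha.1
  have pb := present_of_termSign_ne_zero ε _ hb.1
  have pc := present_of_termSign_ne_zero ε _ hc.1
  have hDp : termSign ε ((1 : Equiv.Perm (Fin 3)), lam) ≠ 0 := by
    refine termSign_ne_zero_of_forall ε 1 lam fun l => ?_
    rw [Equiv.Perm.coe_one, id_eq]
    rcases eq_or_eq_or_eq_three hij hki hkj l with rfl | rfl | rfl
    · rw [li]; have := pa l; rwa [Equiv.swap_apply_of_ne_of_ne hij hik] at this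
    · rw [lj]; have := pb l; rwa [Equiv.swap_apply_of_ne_of_ne hij.symm hjk] at this
    · rw [lk]; have := pc l; rwa [Equiv.swap_apply_of_ne_of_ne hki hkj] at this
  have hCp : termSign ε (σ, ν) ≠ 0 := by
    refine termSign_ne_zero_of_forall ε σ ν fun l => ?_
    rcases eq_or_eq_or_eq_three hij hki hkj l with rfl | rfl | rfl
    · rw [hσi, ni]; have := pc l; rwa [Equiv.swap_apply_left] at this
    · rw [hσj, nj]; have := pa l; rwa [Equiv.swap_apply_left] at this
    · rw [hσk, nk]; have := pb l; rwa [Equiv.swap_apply_right] at this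
  -- the hybrids lie outside the three orbits (different carriers)
  obtain ⟨n1, n1', n1''⟩ := swap_ij_ne_cycle hij hki hkj σ hσi hσj hσk
  obtain ⟨n2, n2'⟩ := swap_jk_ne_cycle hij hki σ hσi hσj hσk
  obtain ⟨n3, n3'⟩ := swap_ik_ne_cycle hij hkj σ hσi hσj hσk
  have Dne : ∀ (τ : Equiv.Perm (Fin 3)) (ξ : Fin 3 → Fin K), τ ≠ 1 →
      ((1, lam) : Equiv.Perm (Fin 3) × (Fin 3 → Fin K)) ≠ (τ, ξ) ∧
        ((1, lam) : Equiv.Perm (Fin 3) × (Fin 3 → Fin K)) ≠ transposeTerm (τ, ξ) := by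
    intro τ ξ hτ
    refine ⟨term_ne_of_fst_ne (Ne.symm hτ), term_ne_of_fst_ne ?_⟩
    exact fun h => hτ (inv_eq_one.mp h.symm)
  have Cne : ∀ (τ : Equiv.Perm (Fin 3)) (ξ : Fin 3 → Fin K), τ ≠ σ → τ ≠ σ⁻¹ →
      ((σ, ν) : Equiv.Perm (Fin 3) × (Fin 3 → Fin K)) ≠ (τ, ξ) ∧
        ((σ, ν) : Equiv.Perm (Fin 3) × (Fin 3 → Fin K)) ≠ transposeTerm (τ, ξ) := by
    intro τ ξ h1 h2
    refine ⟨term_ne_of_fst_ne (Ne.symm h1), term_ne_of_fst_ne ?_⟩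
    intro h
    have h' : σ = τ⁻¹ := h
    exact h2 (by rw [h', inv_inv])
  -- the six comparisons
  have haD := ha.2 _ (Dne _ _ (swap_ne_one_perm hjk)).1 (Dne _ _ (swap_ne_one_perm hjk)).2 hDp
  have hbD := hb.2 _ (Dne _ _ (swap_ne_one_perm hik)).1 (Dne _ _ (swap_ne_one_perm hik)).2 hDp
  have hcD := hc.2 _ (Dne _ _ (swap_ne_one_perm hij)).1 (Dne _ _ (swap_ne_one_perm hij)).2 hDp
  have haC := ha.2 _ (Cne _ _ n2 n2').1 (Cne _ _ n2 n2').2 hCp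
  have hbC := hb.2 _ (Cne _ _ n3 n3').1 (Cne _ _ n3 n3').2 hCp
  have hcC := hc.2 _ (Cne _ _ n1 n1').1 (Cne _ _ n1 n1').2 hCp
  rw [tropWeight_one_three hij hki hkj, li, lj, lk] at haD hbD hcD
  rw [tropWeight_cycle_three hij hki hkj σ hσi hσj hσk, ni, nj, nk] at haC hbC hcC
  rw [tropWeight_swap_three hjk hij hik d v hv θa ξa hca] at haD haC
  rw [tropWeight_swap_three hik hij.symm hjk d v hv θb ξb hcb] at hbD hbC
  rw [tropWeight_swap_three hij hki hkj d v hv θc ξc hcc] at hcD hcC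
  -- heights bookkeeping: `V(pa) + V(pb) + V(pc) = V(D) + 2·V(C)`
  have hvb : v j j (ξb j) + 2 * v i k (ξb i) = v j j (ξb j) + 2 * v i k (ξb k) := by rw [hcb]
  rw [hvb] at hbD hbC
  have hdb : (d (ξb j) : ℤ) + 2 * d (ξb i) = d (ξb j) + 2 * d (ξb k) := by rw [hcb]
  rw [hdb] at hbD hbC
  have e1 : v j k (ξa j) = v k j (ξa j) := hv j k _
  have e2 : v i j (ξc i) = v j i (ξc i) := hv i j _
  refine centroid3 (AP := (d (ξc i) : ℤ) + d (ξa j) + d (ξb k)) (AQ := (d (ξa i) : ℤ) + d (ξb j) + d (ξc k))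
    (VP := v j i (ξc i) + v k j (ξa j) + v i k (ξb k)) (VQ := v i i (ξa i) + v j j (ξb j) + v k k (ξc k))
    (Va := v i i (ξa i) + 2 * v j k (ξa j)) (Vb := v j j (ξb j) + 2 * v i k (ξb k)) (Vc := v k k (ξc k) + 2 * v i j (ξc i))
    (by ring) (by rw [e1, e2]; ring) haC haD hbC hbD hcC hcD

end Triple

/-! ## Rank form along an alternating orbit chain (the abstract interface of `…TropicalOrbitChainAbstract`) -/

section Chain

variable (d : Fin K → ℕ) (v ε : Fin 3 → Fin 3 → Fin K → ℤ) (hv : ∀ i j l, v i j l = v j i l)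
  {n : ℕ} (θ : Fin (n + 1) → ℤ) (p : Fin (n + 1) → Equiv.Perm (Fin 3) × (Fin 3 → Fin K))
  (hdom : ∀ k, IsOrbitDominant d v ε (θ k) (p k))
include hv hdom

/-- **Rule T3 along the chain, rank form.**  Three chain positions `a, b, c` carrying cycle-constant transpositions fixing the three
distinct cells `i, j, k` (pair ranks equal): with `g = d ∘ Tuple.sort d` and ranks `ρx l = rank of (p x).2 l`, the identity hybrid has
exponent sum `AD = g(ρa i) + g(ρb j) + g(ρc k)`, the pair hybrid `AC = g(ρc i) + g(ρa j) + g(ρb k)`, and the three terms `g(ρa i) + 2 g(ρa j)`,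
`g(ρb j) + 2 g(ρb k)`, `g(ρc k) + 2 g(ρc i)`; they are not all weakly between `AC` and `AD` (either way round).  No order of `a, b, c` is
assumed. [rule_T3] -/
theorem orbitChain_T3 (a b c : Fin (n + 1)) {i j k : Fin 3} (hij : i ≠ j) (hki : k ≠ i) (hkj : k ≠ j)
    (ha1 : (p a).1 = Equiv.swap j k) (hca : (Tuple.sort d).symm ((p a).2 j) = (Tuple.sort d).symm ((p a).2 k))
    (hb1 : (p b).1 = Equiv.swap i k) (hcb : (Tuple.sort d).symm ((p b).2 i) = (Tuple.sort d).symm ((p b).2 k))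
    (hc1 : (p c).1 = Equiv.swap i j) (hcc : (Tuple.sort d).symm ((p c).2 i) = (Tuple.sort d).symm ((p c).2 j)) :
    let g : Fin K → ℕ := d ∘ Tuple.sort d
    let ρ : Fin (n + 1) → Fin 3 → Fin K := fun x l => (Tuple.sort d).symm ((p x).2 l)
    ¬ (g (ρ c i) + g (ρ a j) + g (ρ b k) ≤ g (ρ a i) + 2 * g (ρ a j) ∧
        g (ρ c i) + g (ρ a j) + g (ρ b k) ≤ g (ρ b j) + 2 * g (ρ b k) ∧
        g (ρ c i) + g (ρ a j) + g (ρ b k) ≤ g (ρ c k) + 2 * g (ρ c i) ∧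
        g (ρ a i) + 2 * g (ρ a j) ≤ g (ρ a i) + g (ρ b j) + g (ρ c k) ∧
        g (ρ b j) + 2 * g (ρ b k) ≤ g (ρ a i) + g (ρ b j) + g (ρ c k) ∧
        g (ρ c k) + 2 * g (ρ c i) ≤ g (ρ a i) + g (ρ b j) + g (ρ c k)) ∧
    ¬ (g (ρ a i) + g (ρ b j) + g (ρ c k) ≤ g (ρ a i) + 2 * g (ρ a j) ∧
        g (ρ a i) + g (ρ b j) + g (ρ c k) ≤ g (ρ b j) + 2 * g (ρ b k) ∧
        g (ρ a i) + g (ρ b j) + g (ρ c k) ≤ g (ρ c k) + 2 * g (ρ c i) ∧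
        g (ρ a i) + 2 * g (ρ a j) ≤ g (ρ c i) + g (ρ a j) + g (ρ b k) ∧
        g (ρ b j) + 2 * g (ρ b k) ≤ g (ρ c i) + g (ρ a j) + g (ρ b k) ∧
        g (ρ c k) + 2 * g (ρ c i) ≤ g (ρ c i) + g (ρ a j) + g (ρ b k)) := by
  intro g ρ
  simp only [g, ρ, sort_symm_apply]
  have hμa : (p a).2 j = (p a).2 k := (Tuple.sort d).symm.injective hca
  have hμb : (p b).2 i = (p b).2 k := (Tuple.sort d).symm.injective hcb
  have hμc : (p c).2 i = (p c).2 j := (Tuple.sort d).symm.injective hcc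
  have hA : IsOrbitDominant d v ε (θ a) (Equiv.swap j k, (p a).2) := by rw [← ha1]; exact hdom a
  have hB : IsOrbitDominant d v ε (θ b) (Equiv.swap i k, (p b).2) := by rw [← hb1]; exact hdom b
  have hC : IsOrbitDominant d v ε (θ c) (Equiv.swap i j, (p c).2) := by rw [← hc1]; exact hdom c
  obtain ⟨σ, hσi, hσj, hσk⟩ : ∃ σ : Equiv.Perm (Fin 3), σ i = j ∧ σ j = k ∧ σ k = i :=
    ⟨Equiv.swap i k * Equiv.swap i j, by
      refine ⟨?_, ?_, ?_⟩ <;> simp [Equiv.Perm.mul_apply, Equiv.swap_apply_left, Equiv.swap_apply_right,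
        Equiv.swap_apply_of_ne_of_ne, hki, hkj, hij.symm, hkj.symm]⟩
  have h := rule_T3 hij hki hkj σ hσi hσj hσk d v ε hv (p a).2 (p b).2 (p c).2 hA hμa hB hμb hC hμc
  exact_mod_cast h

end Chain

end Summit.ValiantsHypothesis.ValiantsHypothesis.Theorems.LacunarySymmetroidMatrixDescartes.TropicalCensus.Orbit
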